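import Summits.QuantumFields.GaugeBoot.Rows.GLYZc1D4HTab
import HarnessLib

/-!
# Gauge-boot: kernel check of the raw `H` class table, rows 121–210 (part 4/4)

Cell `pub-gaugeboot` (HOME `run/shared/lean/pub/pub-gaugeboot/`), seat lean1 (binding layer for rows C20–C31 = the certified
glyz-c1-rp-4D windows, FANOUT-PLAN A126 (2): label sets, class/witness tables, the reduction identity, soundness, per-β bindings).

HONEST FRAMING (page 1 of every file of this cell): certified bounds on lattice expectations at STATED coupling,
gauge group, dimension and torus size; NOT a mass gap, NOT a continuum limit, NOT a string tension, NOT large `N`.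
The venture is explicitly NOT Yang–Mills-summit-bearing (barriers `FixedCouplingUltralocality`,
`PerturbativeInvisibility`).

`hcanon_rows_<lo>_<hi> : ∀ i, lo ≤ i < hi → ∀ j ≥ i, HCanonOK i j`, each range one closed computation (`decide +kernel`);
assembled in `GLYZc1D4Canon`.
-/

noncomputable section

open Literature.MathematicalPhysics.QuantumFieldTheory

namespace Summit.QuantumFields.GaugeBoot

namespace GLYZc1D4

set_option maxHeartbeats 0 in
/-- Rows `121 ≤ i < 135` of the `H` class table canonicalise (1169 entries; closed computation checked by the kernel). -/
theorem hcanon_rows_121_135 : ∀ i : Fin 211, 121 ≤ i.val → i.val < 135 → ∀ j : Fin 211, i.val ≤ j.val → HCanonOK i j := by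
  decide +kernel

set_option maxHeartbeats 0 in
/-- Rows `135 ≤ i < 152` of the `H` class table canonicalise (1156 entries; closed computation checked by the kernel). -/
theorem hcanon_rows_135_152 : ∀ i : Fin 211, 135 ≤ i.val → i.val < 152 → ∀ j : Fin 211, i.val ≤ j.val → HCanonOK i j := by
  decide +kernel

set_option maxHeartbeats 0 in
/-- Rows `152 ≤ i < 177` of the `H` class table canonicalise (1175 entries; closed computation checked by the kernel). -/
theorem hcanon_rows_152_177 : ∀ i : Fin 211, 152 ≤ i.val → i.val < 177 → ∀ j : Fin 211, i.val ≤ j.val → HCanonOK i j := by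
  decide +kernel

set_option maxHeartbeats 0 in
/-- Rows `177 ≤ i < 211` of the `H` class table canonicalise (595 entries; closed computation checked by the kernel). -/
theorem hcanon_rows_177_211 : ∀ i : Fin 211, 177 ≤ i.val → i.val < 211 → ∀ j : Fin 211, i.val ≤ j.val → HCanonOK i j := by
  decide +kernel

end GLYZc1D4

end Summit.QuantumFields.GaugeBoot

end
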